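/-
Copyright (c) 2026 the pub-hodgecm-mathlib formalisation cell (harness21).  Prover seat hodgecm-mathlib-LH4-p07 (g7), Track A «(D-RAM) FOUR-FRAME», unit U2H, the census leaf
(ρ2b′-X) `stub_U2H_fixedPointCensus_typeTwo_unit0` — seam S2′ «THIRD-FIELD PACKAGE», the ADAPTERS half (LH4-p05 (g4) 05:45:25Z co-hand; payer LH4-p14 (g4) MAP v2 bde9a80f):
the ★ T5a level tables, the ★ (R1-TOP-SIDE) bit laws and the ★ T5s WELD on type U with the fourteen third-field binders DISCHARGED by ★ `exists_thirdFieldPackage_unr`.  2026-09-04.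
-/
import Summits.HodgeConjecture.HodgeConjecture.Theorems.F0P3cDyRamThirdFieldPackageUnr          -- ★ S2′ (LH4-p05 (g4)) `exists_thirdFieldPackage_unr`
import Summits.HodgeConjecture.HodgeConjecture.Theorems.F0P3cDyRamToricCensusSumUnrWeld          -- ★ p857797 (LH4-p08 (g5)) `toricCensusSum_unr_weld`; brings Top, TopAniso, TopSide, Unr, UnrAniso
import Literature.NumberTheory.LocalFields.ValuedCompleteIsAdicComplete                       -- ★ BRIDGE-AC `isAdicComplete_valuedInteger_of_completeSpace`
import HarnessLib

/-!
# T5a ∕ T5s at the frame, type U: the third field DISCHARGED (S2′ adapters)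

Every ★ T5a head of the K-unramified toric level census (LH4-p08: `ncard_levelSet_unr_hyper`, `ncard_levelSet_unr_aniso`, `ncard_levelSetDep_top_hyper`,
`ncard_levelSetDep_top_aniso`, the bit laws `topBit_hyper_iff'` ∕ `topBit_aniso_iff`) and the ★ T5s WELD `toricCensusSum_unr_weld` take the third field `K♮`
ABSTRACTLY: a valued field `K'` with `[IsDiscreteValuationRing 𝒪[K']] [Finite 𝓀[K']]` (and `[IsAdicComplete 𝓂[K'] 𝒪[K']]` for the bit laws and the weld),
an involution `σ'`, a uniformiser `π'` with `|π' − σ'π'| = |π'|^d`, `#𝓀[K'] = q`, and an isometric embedding `jK : K' →+* K` onto the `Θ`-fixed elements with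
`jK ∘ σ' = ρ ∘ jK` and the unit-norm surjectivity `hnorm` — fourteen binders in all.  ★ S2′ `exists_thirdFieldPackage_unr` (LH4-p05 (g4), route (b′): `K' := Fix Θ`
as a type) PRODUCES them from the frame's own one-field letters plus three transported E-datum clauses: the Unr-K case-definer `hτα : |ρα − Θα| < 1`, the Θ-depth
of the ρ-fixed uniformiser `hddE : |ϖE − ΘϖE| = |ϖE|^d`, and the even-order clause `hfixE` for doubly fixed elements.

THIS FILE is the consumer-side seam: each ★ row restated with the fourteen `K'`-binders REPLACED by `[CompleteSpace K]` + `hτα`, `hd`, `hddE`, `hfixE`, the body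
being `obtain ⟨K', …⟩ := exists_thirdFieldPackage_unr …; exact ★row …`.  The one non-bookkeeping point is completeness of `K'` (needed by the bit laws and the
weld as `IsAdicComplete 𝓂[K'] 𝒪[K']`), which the package does not export and need not: §0 derives `CompleteSpace K'` from the package's own outputs — `jK` is a
uniform embedding (isometry of `ℤᵐ⁰`-valued fields) whose range `{z | Θ z = z}` is closed in the complete `K` — and ★ BRIDGE-AC turns it into `IsAdicComplete`.

* §0 `continuous_of_v_map_eq`, `isUniformInducing_of_v_map_eq`, `completeSpace_of_v_map_eq_of_range_eq_fixed` (generic valued-field topology).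
* §1 the four level tables at the frame: `ncard_levelSet_unr_hyper_of_frame`, `ncard_levelSet_unr_aniso_of_frame`, `ncard_levelSetDep_top_hyper_of_frame`,
  `ncard_levelSetDep_top_aniso_of_frame`.
* §2 the two bit laws at the frame: `topBit_hyper_iff_of_frame`, `topBit_aniso_iff_of_frame`.
* §3 **`toricCensusSum_unr_weld_of_frame`** — the ONE name the census top (C0-final) consumes on type U (payer LH4-p14 (g4); LH4-p08 (g5) 06:04:20Z).

Binder order in every theorem: frame `hρρ hvρ hΘΘ hΘρ hvΘ hα1 hα hρϖE hϖE`, residue size `hq`, the S2′ inputs `hτα hd hddE hfixE`, then the ★ row's remaining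
letters in the ★ row's own order.  Conclusions are the ★ rows' conclusions byte for byte.
HONEST LABEL: HC_CM is proved only modulo the 7 printed citations (2 remaining named inputs: hLiu418 = stmt-HodgeConjecture-24832,
h413 = stmt-HodgeConjecture-24833) until rung 0 closes; (ρ2b′-X) :418 is an OPEN prover target — this file is a helper (`--supports`), proofs only, closes no socket.
-/

set_option autoImplicit false

open WithZero IsLocalRing Finset
open scoped Valued Topology

namespace Summit.HodgeConjecture.HodgeConjecture.Cruxes.H413.F0P3cDyRamToricLevelCensusUnrAtThirdField

open Summit.HodgeConjecture.HodgeConjecture.Cruxes.H413.F0P3cDyRamToricCensusDefs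
open Summit.HodgeConjecture.HodgeConjecture.Cruxes.H413.F0P3cDyRamThirdFieldPackageUnr (exists_thirdFieldPackage_unr)
open Summit.HodgeConjecture.HodgeConjecture.Cruxes.H413.F0P3cDyRamToricLevelCensusUnr
open Literature.NumberTheory.LocalFields (isAdicComplete_valuedInteger_of_completeSpace)

/-! ## §0 Completeness of the third field from the package's own outputs -/

section Topology

variable {K : Type*} [Field K] [Valued K ℤᵐ⁰] {K' : Type*} [Field K'] [Valued K' ℤᵐ⁰]

/-- A ring endomorphism of a `ℤᵐ⁰`-valued field preserving the valuation is continuous. [cite: Serre1979, Ch. II §1] -/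
theorem continuous_of_v_map_eq {Θ : K →+* K} (hvΘ : ∀ x, Valued.v (Θ x) = Valued.v x) : Continuous Θ := by
  refine continuous_of_continuousAt_zero Θ ?_
  rw [ContinuousAt, map_zero, (Valued.hasBasis_nhds_zero K ℤᵐ⁰).tendsto_iff (Valued.hasBasis_nhds_zero K ℤᵐ⁰)]
  intro γ _
  refine ⟨γ, trivial, fun x hx => ?_⟩
  simp only [Set.mem_setOf_eq, Valuation.restrict_lt_iff_lt_embedding] at hx ⊢
  rwa [hvΘ]

/-- A valuation-preserving ring homomorphism between `ℤᵐ⁰`-valued fields, the source carrying a uniformiser `π'`, induces the uniform structure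
(it is a uniform embedding): the basic entourages `{|y − x| < |π'|ⁿ}` are cofinal on both sides. [cite: Serre1979, Ch. II §1] -/
theorem isUniformInducing_of_v_map_eq (jK : K' →+* K) (hjv : ∀ x, Valued.v (jK x) = Valued.v x)
    {π' : K'} (hπ' : Valued.v π' = exp (-1 : ℤ)) : IsUniformInducing jK := by
  have hπ'1 : Valued.v π' < 1 := by rw [hπ', ← exp_zero, exp_lt_exp]; norm_num
  have hpow0 : ∀ n : ℕ, Valued.v (π' ^ n) ≠ 0 := fun n => by rw [map_pow, hπ']; exact pow_ne_zero _ exp_ne_zero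
  refine ⟨le_antisymm ?_ ?_⟩
  · -- `comap (jK × jK) 𝓤_K ≤ 𝓤_{K'}`: the `K'`-ball of radius `γ'` contains the pulled-back `K`-ball of radius `|jK π'ⁿ|`, `|π'|ⁿ < γ'`
    rw [(Valued.hasBasis_uniformity K' ℤᵐ⁰).ge_iff]
    intro γ' _
    obtain ⟨n, hn⟩ := exists_pow_lt₀ hπ'1 (Units.map (MonoidWithZeroHom.ValueGroup₀.embedding (f := (.ofClass (Valued.v : Valuation K' ℤᵐ⁰)))) γ')
    have hne : Valued.v.restrict (jK (π' ^ n)) ≠ 0 := by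
      rw [ne_eq, Valuation.restrict_eq_zero_iff, hjv]; exact hpow0 n
    refine ⟨{p : K × K | Valued.v.restrict (p.2 - p.1) < ((Units.mk0 _ hne : (MonoidWithZeroHom.ValueGroup₀ _)ˣ) : _)},
      (Valued.hasBasis_uniformity K ℤᵐ⁰).mem_of_mem trivial, fun p hp => ?_⟩
    simp only [Set.mem_preimage, Set.mem_setOf_eq, Units.val_mk0, Valuation.restrict_lt_iff] at hp
    rw [← map_sub] at hp
    simp only [hjv, map_pow] at hp
    simp only [Set.mem_setOf_eq, Valuation.restrict_lt_iff_lt_embedding]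
    have h := hp.trans hn
    rwa [Units.coe_map, MonoidHom.coe_coe] at h
  · -- `𝓤_{K'} ≤ comap (jK × jK) 𝓤_K`: the pulled-back `K`-ball of radius `γ` contains the `K'`-ball of radius `|π'ⁿ|`, `|π'|ⁿ < γ`
    rw [((Valued.hasBasis_uniformity K ℤᵐ⁰).comap (fun x : K' × K' => (jK x.1, jK x.2))).ge_iff]
    intro γ _
    obtain ⟨n, hn⟩ := exists_pow_lt₀ hπ'1 (Units.map (MonoidWithZeroHom.ValueGroup₀.embedding (f := (.ofClass (Valued.v : Valuation K ℤᵐ⁰)))) γ)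
    have hne' : Valued.v.restrict (π' ^ n) ≠ 0 := by rw [ne_eq, Valuation.restrict_eq_zero_iff]; exact hpow0 n
    refine Filter.mem_of_superset
      ((Valued.hasBasis_uniformity K' ℤᵐ⁰).mem_of_mem (i := (Units.mk0 _ hne' : (MonoidWithZeroHom.ValueGroup₀ _)ˣ)) trivial) fun p hp => ?_
    simp only [Set.mem_setOf_eq, Units.val_mk0, Valuation.restrict_lt_iff] at hp
    rw [map_pow] at hp
    simp only [Set.mem_preimage, Set.mem_setOf_eq, Valuation.restrict_lt_iff_lt_embedding, ← map_sub, hjv]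
    have h := hp.trans hn
    rwa [Units.coe_map, MonoidHom.coe_coe] at h

/-- **COMPLETENESS OF THE THIRD FIELD.**  If `K` is complete, `Θ : K →+* K` preserves the valuation, and `jK : K' →+* K` is a valuation-preserving embedding of a
field with a uniformiser `π'` whose range is exactly the `Θ`-fixed elements, then `K'` is complete: `jK` is a uniform embedding with closed range in a complete space.
[cite: Serre1979, Ch. II §1, §3] -/
theorem completeSpace_of_v_map_eq_of_range_eq_fixed [CompleteSpace K] {Θ : K →+* K} (hvΘ : ∀ x, Valued.v (Θ x) = Valued.v x)
    (jK : K' →+* K) (hjv : ∀ x, Valued.v (jK x) = Valued.v x) {π' : K'} (hπ' : Valued.v π' = exp (-1 : ℤ))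
    (hjΘ : ∀ x, Θ (jK x) = jK x) (hjfix : ∀ z : K, Θ z = z → ∃ x, jK x = z) : CompleteSpace K' := by
  rw [completeSpace_iff_isComplete_range (isUniformInducing_of_v_map_eq jK hjv hπ')]
  have hrange : Set.range jK = {z : K | Θ z = z} := by
    ext z
    constructor
    · rintro ⟨x, rfl⟩
      exact hjΘ x
    · intro hz
      obtain ⟨x, hx⟩ := hjfix z hz
      exact ⟨x, hx⟩
  rw [hrange]
  exact (isClosed_eq (continuous_of_v_map_eq hvΘ) continuous_id).isComplete

end Topology

/-! ## §1 The four ★ T5a level tables at the frame (third field discharged) -/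

variable {K : Type} [Field K] [Valued K ℤᵐ⁰] {ρ Θ : K →+* K} {α ϖE : K} {d t q : ℕ}

/-- **T5a HYPERBOLIC LEVEL TABLE AT THE FRAME** (★ `ncard_levelSet_unr_hyper` with the third field supplied by ★ S2′ `exists_thirdFieldPackage_unr`):
`#levelSet(j,a) = (q² − 1)·q^{j − 2 − (j−a−d)∕2}` if `1 ≤ a`, `a + d ≤ j`, `j − a − d` even; `= (q+1)·q^{(j+d)∕2 − 1}` if `a = 0`, `j + d` even, `d ≤ j`; `= |G_j|` if
`a = 0`, `j + d` even, `j < d`; `= 0` otherwise. [cite: Flicker1998UnitaryFL, Prop. 7 p. 84] [cite: Serre1979, Ch. V §3] [cite: Kottwitz1986BaseChangeUnits, §1 pp. 240–241] -/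
theorem ncard_levelSet_unr_hyper_of_frame [CompleteSpace K] [IsDiscreteValuationRing 𝒪[K]] [Finite 𝓀[K]]
    (hρρ : ∀ x, ρ (ρ x) = x) (hvρ : ∀ x, Valued.v (ρ x) = Valued.v x) (hΘΘ : ∀ x, Θ (Θ x) = x) (hΘρ : ∀ x, Θ (ρ x) = ρ (Θ x))
    (hvΘ : ∀ x, Valued.v (Θ x) = Valued.v x) (hα1 : Valued.v α ≤ 1) (hα : Valued.v (α - ρ α) = 1)
    (hρϖE : ρ ϖE = ϖE) (hϖE : Valued.v ϖE = exp (-1 : ℤ)) (hq : Nat.card 𝓀[K] = q ^ 2)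
    (hτα : Valued.v (ρ α - Θ α) < 1) (hd : 1 ≤ d) (hddE : Valued.v (ϖE - Θ ϖE) = Valued.v ϖE ^ d)
    (hfixE : ∀ z : K, ρ z = z → Θ z = z → z ≠ 0 → ∃ n : ℤ, Valued.v z = exp (2 * n))
    {h : K} (hΘh : Θ h = h) (hh : h ≠ 0) (hhyper : ∃ x : K, x ≠ 0 ∧ h * Θ x * x + ρ (h * Θ x * x) = 0) (j a : ℕ) :
    (levelSet ρ Θ α ϖE h j a).ncard =
      if 1 ≤ a ∧ a + d ≤ j ∧ (j - a - d) % 2 = 0 then (q ^ 2 - 1) * q ^ (j - 2 - (j - a - d) / 2)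
      else if a = 0 ∧ (j + d) % 2 = 0 then (if d ≤ j then (q + 1) * q ^ ((j + d) / 2 - 1) else (if j = 0 then 1 else (q + 1) * q ^ (j - 1)))
      else 0 := by
  obtain ⟨K', _iF, _iV, σ', π', jK, hDVR, hfin, hq', hσ', hvσ', hfix', hπ', hdd', hjv, hjΘ, hjfix, hjσ, hnorm⟩ :=
    exists_thirdFieldPackage_unr hq hρρ hvρ hΘΘ hΘρ hvΘ hα1 hα hτα hρϖE hϖE hddE hfixE
  haveI := hDVR; haveI := hfin
  exact ncard_levelSet_unr_hyper hρρ hvρ hΘΘ hΘρ hvΘ hα1 hα hρϖE hϖE hΘh hh hq hσ' hvσ' hfix' hπ' hdd' hd hq' jK hjv hjΘ hjfix hjσ hnorm hhyper j a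

/-- **T5a ANISOTROPIC LEVEL TABLE AT THE FRAME** (★ `ncard_levelSet_unr_aniso`, third field by ★ S2′): `#levelSet(j,a) = |G_j|` exactly on the cells
`(d ≤ j+1 ∧ a + d = j+1) ∨ (j+1 < d ∧ a = 0 ∧ j + d odd)`, `= 0` otherwise (`|G_0| = 1`, `|G_j| = (q+1)q^{j−1}`).
[cite: Flicker1998UnitaryFL, Prop. 7 p. 84] [cite: Serre1979, Ch. V §3] [cite: Kottwitz1986BaseChangeUnits, §1 pp. 240–241] -/
theorem ncard_levelSet_unr_aniso_of_frame [CompleteSpace K] [IsDiscreteValuationRing 𝒪[K]] [Finite 𝓀[K]]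
    (hρρ : ∀ x, ρ (ρ x) = x) (hvρ : ∀ x, Valued.v (ρ x) = Valued.v x) (hΘΘ : ∀ x, Θ (Θ x) = x) (hΘρ : ∀ x, Θ (ρ x) = ρ (Θ x))
    (hvΘ : ∀ x, Valued.v (Θ x) = Valued.v x) (hα1 : Valued.v α ≤ 1) (hα : Valued.v (α - ρ α) = 1)
    (hρϖE : ρ ϖE = ϖE) (hϖE : Valued.v ϖE = exp (-1 : ℤ)) (hq : Nat.card 𝓀[K] = q ^ 2)
    (hτα : Valued.v (ρ α - Θ α) < 1) (hd : 1 ≤ d) (hddE : Valued.v (ϖE - Θ ϖE) = Valued.v ϖE ^ d)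
    (hfixE : ∀ z : K, ρ z = z → Θ z = z → z ≠ 0 → ∃ n : ℤ, Valued.v z = exp (2 * n))
    {h : K} (hΘh : Θ h = h) (hh : h ≠ 0) (haniso : ¬ ∃ x : K, x ≠ 0 ∧ h * Θ x * x + ρ (h * Θ x * x) = 0) (j a : ℕ) :
    (levelSet ρ Θ α ϖE h j a).ncard =
      if (d ≤ j + 1 ∧ a + d = j + 1) ∨ (j + 1 < d ∧ a = 0 ∧ (j + d) % 2 = 1) then (if j = 0 then 1 else (q + 1) * q ^ (j - 1)) else 0 := by
  obtain ⟨K', _iF, _iV, σ', π', jK, _hDVR, _hfin, _hq', hσ', hvσ', hfix', hπ', hdd', hjv, hjΘ, hjfix, hjσ, hnorm⟩ :=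
    exists_thirdFieldPackage_unr hq hρρ hvρ hΘΘ hΘρ hvΘ hα1 hα hτα hρϖE hϖE hddE hfixE
  exact ncard_levelSet_unr_aniso hρρ hvρ hΘΘ hΘρ hvΘ hα1 hα hρϖE hϖE hΘh hh hq hσ' hvσ' hfix' hπ' hdd' hd jK hjv hjΘ hjfix hjσ hnorm haniso j a

open scoped Classical in
/-- **(R1-TOP, HYPERBOLIC) AT THE FRAME** (★ `ncard_levelSetDep_top_hyper`, third field by ★ S2′): on the top diagonal `j + m = jλ + a`, `m + 1 ≤ 2a`,
`(q−1)·q^{⌈(2a−m)∕2⌉−1}·#levelSetDep(j,a;μ) = [top bit]·#levelSet(j,a)`. [cite: Flicker1998UnitaryFL, p. 84] [cite: Serre1979, Ch. V §3] -/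
theorem ncard_levelSetDep_top_hyper_of_frame [CompleteSpace K] [IsDiscreteValuationRing 𝒪[K]] [Finite 𝓀[K]]
    (hρρ : ∀ x, ρ (ρ x) = x) (hvρ : ∀ x, Valued.v (ρ x) = Valued.v x) (hΘΘ : ∀ x, Θ (Θ x) = x) (hΘρ : ∀ x, Θ (ρ x) = ρ (Θ x))
    (hvΘ : ∀ x, Valued.v (Θ x) = Valued.v x) (hα1 : Valued.v α ≤ 1) (hα : Valued.v (α - ρ α) = 1)
    (hρϖE : ρ ϖE = ϖE) (hϖE : Valued.v ϖE = exp (-1 : ℤ)) (hq : Nat.card 𝓀[K] = q ^ 2)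
    (hτα : Valued.v (ρ α - Θ α) < 1) (hd : 1 ≤ d) (hddE : Valued.v (ϖE - Θ ϖE) = Valued.v ϖE ^ d)
    (hfixE : ∀ z : K, ρ z = z → Θ z = z → z ≠ 0 → ∃ n : ℤ, Valued.v z = exp (2 * n))
    {h : K} (hΘh : Θ h = h) (hh : h ≠ 0) (hhyper : ∃ x : K, x ≠ 0 ∧ h * Θ x * x + ρ (h * Θ x * x) = 0)
    {μ : K} {m jl : ℕ} (hm : Valued.v μ = exp (-(m : ℤ))) (hjl : Valued.v (μ - ρ μ) = exp (-(jl : ℤ)))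
    {j a : ℕ} (hj : j ≤ jl) (ha : 1 ≤ a) (hdiag : j + m = jl + a) (htop : m + 1 ≤ 2 * a) :
    (q - 1) * q ^ ((2 * a - m + 1) / 2 - 1) * (levelSetDep ρ Θ α ϖE h j a μ).ncard =
      if ∃ N : K, Θ N = N ∧ Valued.v N = 1 ∧ Valued.v (ρ h / h * (ρ N / N) + ρ μ / μ) ≤ exp (-((j + a : ℕ) - (m : ℤ)))
      then (levelSet ρ Θ α ϖE h j a).ncard else 0 := by
  obtain ⟨K', _iF, _iV, σ', π', jK, hDVR, hfin, hq', hσ', hvσ', hfix', hπ', hdd', hjv, hjΘ, hjfix, hjσ, hnorm⟩ :=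
    exists_thirdFieldPackage_unr hq hρρ hvρ hΘΘ hΘρ hvΘ hα1 hα hτα hρϖE hϖE hddE hfixE
  haveI := hDVR; haveI := hfin
  exact ncard_levelSetDep_top_hyper hρρ hvρ hΘΘ hΘρ hvΘ hα1 hα hρϖE hϖE hΘh hh hq hσ' hvσ' hfix' hπ' hdd' hd hq' jK hjv hjΘ hjfix hjσ hnorm hhyper
    hm hjl hj ha hdiag htop

open scoped Classical in
/-- **(R1-TOP, ANISOTROPIC) AT THE FRAME** (★ `ncard_levelSetDep_top_aniso`, third field by ★ S2′): on the top diagonal,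
`q^{⌊(2a−m)∕2⌋}·#levelSetDep(j,a;μ) = [top bit]·#levelSet(j,a)`. [cite: Flicker1998UnitaryFL, p. 84] [cite: Serre1979, Ch. V §3] -/
theorem ncard_levelSetDep_top_aniso_of_frame [CompleteSpace K] [IsDiscreteValuationRing 𝒪[K]] [Finite 𝓀[K]]
    (hρρ : ∀ x, ρ (ρ x) = x) (hvρ : ∀ x, Valued.v (ρ x) = Valued.v x) (hΘΘ : ∀ x, Θ (Θ x) = x) (hΘρ : ∀ x, Θ (ρ x) = ρ (Θ x))
    (hvΘ : ∀ x, Valued.v (Θ x) = Valued.v x) (hα1 : Valued.v α ≤ 1) (hα : Valued.v (α - ρ α) = 1)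
    (hρϖE : ρ ϖE = ϖE) (hϖE : Valued.v ϖE = exp (-1 : ℤ)) (hq : Nat.card 𝓀[K] = q ^ 2)
    (hτα : Valued.v (ρ α - Θ α) < 1) (hd : 1 ≤ d) (hddE : Valued.v (ϖE - Θ ϖE) = Valued.v ϖE ^ d)
    (hfixE : ∀ z : K, ρ z = z → Θ z = z → z ≠ 0 → ∃ n : ℤ, Valued.v z = exp (2 * n))
    {h : K} (hΘh : Θ h = h) (hh : h ≠ 0) (haniso : ¬ ∃ x : K, x ≠ 0 ∧ h * Θ x * x + ρ (h * Θ x * x) = 0)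
    {μ : K} {m jl : ℕ} (hm : Valued.v μ = exp (-(m : ℤ))) (hjl : Valued.v (μ - ρ μ) = exp (-(jl : ℤ)))
    {j a : ℕ} (hj : j ≤ jl) (ha : 1 ≤ a) (hdiag : j + m = jl + a) (htop : m + 1 ≤ 2 * a) :
    q ^ ((2 * a - m) / 2) * (levelSetDep ρ Θ α ϖE h j a μ).ncard =
      if ∃ N : K, Θ N = N ∧ Valued.v N = 1 ∧ Valued.v (ρ h / h * (ρ N / N) + ρ μ / μ) ≤ exp (-((j + a : ℕ) - (m : ℤ)))
      then (levelSet ρ Θ α ϖE h j a).ncard else 0 := by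
  obtain ⟨K', _iF, _iV, σ', π', jK, hDVR, hfin, hq', hσ', hvσ', hfix', hπ', hdd', hjv, hjΘ, hjfix, hjσ, hnorm⟩ :=
    exists_thirdFieldPackage_unr hq hρρ hvρ hΘΘ hΘρ hvΘ hα1 hα hτα hρϖE hϖE hddE hfixE
  haveI := hDVR; haveI := hfin
  exact ncard_levelSetDep_top_aniso hρρ hvρ hΘΘ hΘρ hvΘ hα1 hα hρϖE hϖE hΘh hh hq hσ' hvσ' hfix' hπ' hdd' hd hq' jK hjv hjΘ hjfix hjσ hnorm haniso
    hm hjl hj ha hdiag htop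

/-! ## §2 The two ★ (R1-TOP-SIDE) bit laws at the frame (third field and its completeness discharged) -/

/-- **(R1-TOP-SIDE, HYPERBOLIC) BIT LAW AT THE FRAME** (★ `topBit_hyper_iff'`, third field by ★ S2′, `IsAdicComplete 𝓂[K'] 𝒪[K']` by §0 + ★ BRIDGE-AC):
for `μ = λ − u` on the top diagonal, `[∃ Θ-fixed unit N : |(ρh∕h)(ρN∕N) + ρμ∕μ| ≤ exp(−(j+a−m))] ↔ (d + m ≤ jλ ∧ jλ − d − m even) ∧ 2j + d ≤ 2jλ + 1`.
[cite: Serre1979, Ch. V §3 Prop. 5, Cor. 3] [cite: Jacobowitz1962, §4] [cite: Flicker1998UnitaryFL, p. 84] -/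
theorem topBit_hyper_iff_of_frame [CompleteSpace K] [IsDiscreteValuationRing 𝒪[K]] [Finite 𝓀[K]]
    (hρρ : ∀ x, ρ (ρ x) = x) (hvρ : ∀ x, Valued.v (ρ x) = Valued.v x) (hΘΘ : ∀ x, Θ (Θ x) = x) (hΘρ : ∀ x, Θ (ρ x) = ρ (Θ x))
    (hvΘ : ∀ x, Valued.v (Θ x) = Valued.v x) (hα1 : Valued.v α ≤ 1) (hα : Valued.v (α - ρ α) = 1)
    (hρϖE : ρ ϖE = ϖE) (hϖE : Valued.v ϖE = exp (-1 : ℤ)) (hq : Nat.card 𝓀[K] = q ^ 2)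
    (hτα : Valued.v (ρ α - Θ α) < 1) (hd : 1 ≤ d) (hddE : Valued.v (ϖE - Θ ϖE) = Valued.v ϖE ^ d)
    (hfixE : ∀ z : K, ρ z = z → Θ z = z → z ≠ 0 → ∃ n : ℤ, Valued.v z = exp (2 * n))
    (h2 : Valued.v (2 : K) = Valued.v ϖE ^ t) {h : K} (hΘh : Θ h = h) (hh : h ≠ 0)
    (hhyper : ∃ x : K, x ≠ 0 ∧ h * Θ x * x + ρ (h * Θ x * x) = 0)
    {lam u : K} (hlam : lam * Θ lam = 1) (hu : ρ u = u) (hu1 : u * Θ u = 1)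
    {m jl : ℕ} (hm : Valued.v (lam - u) = exp (-(m : ℤ))) (hjl : Valued.v ((lam - u) - ρ (lam - u)) = exp (-(jl : ℤ)))
    {j a : ℕ} (hj : j ≤ jl) (ha : 1 ≤ a) (hdiag : j + m = jl + a) (htop : m + 1 ≤ 2 * a) :
    (∃ N : K, Θ N = N ∧ Valued.v N = 1 ∧ Valued.v (ρ h / h * (ρ N / N) + ρ (lam - u) / (lam - u)) ≤ exp (-((j + a : ℕ) - (m : ℤ)))) ↔
      ((d + m ≤ jl ∧ (jl - d - m) % 2 = 0) ∧ 2 * j + d ≤ 2 * jl + 1) := by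
  obtain ⟨K', _iF, _iV, σ', π', jK, hDVR, hfin, hq', hσ', hvσ', hfix', hπ', hdd', hjv, hjΘ, hjfix, hjσ, hnorm⟩ :=
    exists_thirdFieldPackage_unr hq hρρ hvρ hΘΘ hΘρ hvΘ hα1 hα hτα hρϖE hϖE hddE hfixE
  haveI := hDVR; haveI := hfin
  haveI : CompleteSpace K' := completeSpace_of_v_map_eq_of_range_eq_fixed hvΘ jK hjv hπ' hjΘ hjfix
  haveI : IsAdicComplete 𝓂[K'] 𝒪[K'] := isAdicComplete_valuedInteger_of_completeSpace hπ'
  exact topBit_hyper_iff' hρρ hvρ hΘΘ hΘρ hvΘ hα1 hα hρϖE hϖE h2 hΘh hh hσ' hvσ' hfix' hπ' hdd' hd jK hjv hjΘ hjfix hjσ hnorm hhyper hlam hu hu1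
    hm hjl hj ha hdiag htop

/-- **(R1-TOP-SIDE, ANISOTROPIC) BIT LAW AT THE FRAME** (★ `topBit_aniso_iff`, third field by ★ S2′, completeness by §0 + ★ BRIDGE-AC):
`[∃ Θ-fixed unit N : |(ρh∕h)(ρN∕N) + ρμ∕μ| ≤ exp(−(j+a−m))] ↔ jλ + 1 = d + m ∧ 2j + d ≤ 2jλ + 1`.
[cite: Serre1979, Ch. V §3 Prop. 5, Cor. 3] [cite: Jacobowitz1962, §4] [cite: Flicker1998UnitaryFL, p. 84] -/
theorem topBit_aniso_iff_of_frame [CompleteSpace K] [IsDiscreteValuationRing 𝒪[K]] [Finite 𝓀[K]]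
    (hρρ : ∀ x, ρ (ρ x) = x) (hvρ : ∀ x, Valued.v (ρ x) = Valued.v x) (hΘΘ : ∀ x, Θ (Θ x) = x) (hΘρ : ∀ x, Θ (ρ x) = ρ (Θ x))
    (hvΘ : ∀ x, Valued.v (Θ x) = Valued.v x) (hα1 : Valued.v α ≤ 1) (hα : Valued.v (α - ρ α) = 1)
    (hρϖE : ρ ϖE = ϖE) (hϖE : Valued.v ϖE = exp (-1 : ℤ)) (hq : Nat.card 𝓀[K] = q ^ 2)
    (hτα : Valued.v (ρ α - Θ α) < 1) (hd : 1 ≤ d) (hddE : Valued.v (ϖE - Θ ϖE) = Valued.v ϖE ^ d)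
    (hfixE : ∀ z : K, ρ z = z → Θ z = z → z ≠ 0 → ∃ n : ℤ, Valued.v z = exp (2 * n))
    (h2 : Valued.v (2 : K) = Valued.v ϖE ^ t) {h : K} (hΘh : Θ h = h) (hh : h ≠ 0)
    (haniso : ¬ ∃ x : K, x ≠ 0 ∧ h * Θ x * x + ρ (h * Θ x * x) = 0)
    {lam u : K} (hlam : lam * Θ lam = 1) (hu : ρ u = u) (hu1 : u * Θ u = 1)
    {m jl : ℕ} (hm : Valued.v (lam - u) = exp (-(m : ℤ))) (hjl : Valued.v ((lam - u) - ρ (lam - u)) = exp (-(jl : ℤ)))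
    {j a : ℕ} (hj : j ≤ jl) (ha : 1 ≤ a) (hdiag : j + m = jl + a) (htop : m + 1 ≤ 2 * a) :
    (∃ N : K, Θ N = N ∧ Valued.v N = 1 ∧ Valued.v (ρ h / h * (ρ N / N) + ρ (lam - u) / (lam - u)) ≤ exp (-((j + a : ℕ) - (m : ℤ)))) ↔
      (jl + 1 = d + m ∧ 2 * j + d ≤ 2 * jl + 1) := by
  obtain ⟨K', _iF, _iV, σ', π', jK, hDVR, hfin, hq', hσ', hvσ', hfix', hπ', hdd', hjv, hjΘ, hjfix, hjσ, hnorm⟩ :=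
    exists_thirdFieldPackage_unr hq hρρ hvρ hΘΘ hΘρ hvΘ hα1 hα hτα hρϖE hϖE hddE hfixE
  haveI := hDVR; haveI := hfin
  haveI : CompleteSpace K' := completeSpace_of_v_map_eq_of_range_eq_fixed hvΘ jK hjv hπ' hjΘ hjfix
  haveI : IsAdicComplete 𝓂[K'] 𝒪[K'] := isAdicComplete_valuedInteger_of_completeSpace hπ'
  exact topBit_aniso_iff hρρ hvρ hΘΘ hΘρ hvΘ hα1 hα hρϖE hϖE h2 hΘh hh hσ' hvσ' hfix' hπ' hdd' hd jK hjv hjΘ hjfix hjσ hnorm haniso hlam hu hu1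
    hm hjl hj ha hdiag htop

/-! ## §3 THE ★ T5s WELD AT THE FRAME — the one name the census top consumes on type U -/

/-- **THE T5s WELD ON TYPE U AT THE FRAME** (★ `toricCensusSum_unr_weld` of LH4-p08 (g5) with the fourteen third-field binders discharged by ★ S2′
`exists_thirdFieldPackage_unr` and §0): in the one-field frame `(K = M, ρ, Θ, α, ϖE)` of type U (complete, `#𝓀 = q²`, `|α − ρα| = 1`, ρ-fixed uniformiser `ϖE`
of Θ-depth `d ≥ 1`, doubly-fixed elements of even order, Unr-K case-definer `|ρα − Θα| < 1`, `|2| = |ϖE|^t`), for a HYPERBOLIC scalar `h`, an ANISOTROPIC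
scalar `h′`, the token `μ = λ − u` and ★ T5s's token-side facts:
`ε·Σ_{j < jλ+1} Σ_{a < jλ+2} q^a·(#levelSetDep_h(j,a;μ) − #levelSetDep_{h′}(j,a;μ)) = q^m·((1 + (q+1)·Σ_{i < jλ∕2} q^i) − 2·Σ_{i < d − d%2} q^i)`.
[cite: Kottwitz1986BaseChangeUnits, §1 pp. 240–241] [cite: Rogawski1990, §4.9 Prop. 4.9.1 (b) p. 55, Lemma 4.9.3 p. 56] [cite: Flicker1998UnitaryFL, p. 84] -/
theorem toricCensusSum_unr_weld_of_frame [CompleteSpace K] [IsDiscreteValuationRing 𝒪[K]] [Finite 𝓀[K]]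
    (hρρ : ∀ x, ρ (ρ x) = x) (hvρ : ∀ x, Valued.v (ρ x) = Valued.v x) (hΘΘ : ∀ x, Θ (Θ x) = x) (hΘρ : ∀ x, Θ (ρ x) = ρ (Θ x))
    (hvΘ : ∀ x, Valued.v (Θ x) = Valued.v x) (hα1 : Valued.v α ≤ 1) (hα : Valued.v (α - ρ α) = 1)
    (hρϖE : ρ ϖE = ϖE) (hϖE : Valued.v ϖE = exp (-1 : ℤ)) (hq : Nat.card 𝓀[K] = q ^ 2)
    (hτα : Valued.v (ρ α - Θ α) < 1) (hd : 1 ≤ d) (hddE : Valued.v (ϖE - Θ ϖE) = Valued.v ϖE ^ d)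
    (hfixE : ∀ z : K, ρ z = z → Θ z = z → z ≠ 0 → ∃ n : ℤ, Valued.v z = exp (2 * n))
    (h2 : Valued.v (2 : K) = Valued.v ϖE ^ t)
    {h h' : K} (hΘh : Θ h = h) (hh : h ≠ 0) (hhyper : ∃ x : K, x ≠ 0 ∧ h * Θ x * x + ρ (h * Θ x * x) = 0)
    (hΘh' : Θ h' = h') (hh' : h' ≠ 0) (haniso : ¬ ∃ x : K, x ≠ 0 ∧ h' * Θ x * x + ρ (h' * Θ x * x) = 0)
    {lam u : K} (hlam : lam * Θ lam = 1) (hu : ρ u = u) (hu1 : u * Θ u = 1)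
    {m jl : ℕ} (hm : Valued.v (lam - u) = exp (-(m : ℤ))) (hjl : Valued.v ((lam - u) - ρ (lam - u)) = exp (-(jl : ℤ)))
    (hq2 : 2 ≤ q) (hd2 : 2 ≤ d) (hjl2 : jl % 2 = 0) (hmS : d - d % 2 ≤ m + 1) (ε : ℚ)
    (hreal : (ε = 1 ∧ m % 2 = d % 2 ∧ 1 ≤ m ∧ m + d ≤ jl) ∨ (ε = -1 ∧ m = jl - d + 1 ∧ d ≤ jl)) :
    ε * ∑ j ∈ range (jl + 1), ∑ a ∈ range (jl + 2), (q : ℚ) ^ a *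
        (((levelSetDep ρ Θ α ϖE h j a (lam - u)).ncard : ℚ) - ((levelSetDep ρ Θ α ϖE h' j a (lam - u)).ncard : ℚ)) =
      (q : ℚ) ^ m * ((1 + ((q : ℚ) + 1) * ∑ i ∈ range (jl / 2), (q : ℚ) ^ i) - 2 * ∑ i ∈ range (d - d % 2), (q : ℚ) ^ i) := by
  obtain ⟨K', _iF, _iV, σ', π', jK, hDVR, hfin, hq', hσ', hvσ', hfix', hπ', hdd', hjv, hjΘ, hjfix, hjσ, hnorm⟩ :=
    exists_thirdFieldPackage_unr hq hρρ hvρ hΘΘ hΘρ hvΘ hα1 hα hτα hρϖE hϖE hddE hfixE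
  haveI := hDVR; haveI := hfin
  haveI : CompleteSpace K' := completeSpace_of_v_map_eq_of_range_eq_fixed hvΘ jK hjv hπ' hjΘ hjfix
  haveI : IsAdicComplete 𝓂[K'] 𝒪[K'] := isAdicComplete_valuedInteger_of_completeSpace hπ'
  exact toricCensusSum_unr_weld hρρ hvρ hΘΘ hΘρ hvΘ hα1 hα hρϖE hϖE hq h2 hσ' hvσ' hfix' hπ' hdd' hd hq' jK hjv hjΘ hjfix hjσ hnorm hΘh hh hhyper
    hΘh' hh' haniso hlam hu hu1 hm hjl hq2 hd2 hjl2 hmS ε hreal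

end Summit.HodgeConjecture.HodgeConjecture.Cruxes.H413.F0P3cDyRamToricLevelCensusUnrAtThirdField
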